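import Summits.ABC.StewartYu.PadicG3RecordS
import Summits.ABC.StewartYu.PadicG3SchedInst
import HarnessLib

/-!
# Cell abc-stewartyu, crux `Y07Odd` (stmt-ABC-19658), line `gen3-slab-odd`: the record's NAMED INEQUALITIES PACKAGED — `IneqPack S Sc` — and the
# supply from the pack (so the crux skeleton's stubs are one-liners per record branch)

`Summits/ABC/StewartYu/PadicG3RecordPack.lean` — cell `abc-stewartyu` (seat p2-g4, F-odd lead).  One definition `G3Setup.IneqPack S Sc : Prop` = the
conjunction of the five inequality families of `recordSupplyAt'_of_ineqS` over an abstract schedule `Sc : G3Sched n` — (B1) the Siegel count,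
(hK0) level-0 k-steps, (hH) Kummer half-steps, (hO) odd-node k-steps, (hK) symmetric k-steps of the levels `≥ 1` — and
`recordSupplyAt'_of_pack`.  No named fact; p1 g7/g8 proves `IneqPack S P.schedV` (`m = 0`) and `IneqPack S P.sched1` (`m ≥ 1`).

References: Yu. V. Nesterenko, LNM 1819 (2003) Prop 4.1.
-/

noncomputable section

open NormedSpace Finset Polynomial
open Literature.NumberTheory.Transcendental
open Literature.NumberTheory.Transcendental.PadicCW77 (condExp)
open Literature.NumberTheory.Transcendental.CW77.Setup (Tau tauNorm)
open Summit.ABC.StewartYu.GenThreeFrameSpecOdd (RecordOdd)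
open scoped Nat

namespace Summit.ABC.StewartYu

namespace G3Setup

variable {p : ℕ} [Fact p.Prime] (S : G3Setup p) (Sc : G3Sched S.n)

/-- **The record's named inequalities over the schedule `Sc`** (B1 ∧ hK0 ∧ hH ∧ hO ∧ hK of `recordSupplyAt'_of_ineqS`, verbatim).
[cite: Nesterenko2003, Prop 4.1, Lemma 4.3, §4.3; shape only] -/
def IneqPack : Prop :=
  (2 * (Icc (-(S.NS Sc 0 0 : ℤ)) (S.NS Sc 0 0) ×ˢ CW77.Setup.tauSet S.n (S.TordS Sc 0 0)).card * ((p - 1) * p ^ Sc.m) ≤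
      (Sc.L₀ + 1) * ∏ j, (2 * S.sideS Sc j + 1)) ∧
  (∀ ν < S.n, ∀ x₁ : ℤ, |x₁| ≤ (S.NS Sc 0 (ν + 1) : ℤ) → ∀ τ : Tau S.n, tauNorm τ + S.tS Sc 0 ≤ S.TordS Sc 0 ν →
      max (BwC (p := p) Sc.L₀ Sc.H Sc.m * ‖S.Λ / (S.b S.j₀ : ℚ_[p])‖ * (p : ℝ) ^ ((S.tS Sc 0 - 1) / 2) *
            (p : ℝ) ^ condExp p (2 * S.NS Sc 0 ν + 1) (S.tS Sc 0))
        (BwC (p := p) Sc.L₀ Sc.H Sc.m / ((p : ℝ) ^ Sc.m * Real.sqrt p) ^ ((2 * S.NS Sc 0 ν + 1) * S.tS Sc 0)) <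
      1 / S.KC (S.UcardS Sc) (S.PmaxS Sc) Sc.L₀ Sc.H Sc.Sd 0 (S.Lb (S.sideS Sc) 0) x₁ τ) ∧
  (∀ lev < Sc.Sd, ∀ s₁ : ℤ, Odd s₁ → |s₁| ≤ (2 * S.NhS Sc (lev + 1) - 1 : ℤ) → ∀ τ : Tau S.n, tauNorm τ + S.tS Sc lev ≤ S.TordS Sc lev S.n →
      max (BwC (p := p) Sc.L₀ Sc.H Sc.m * ‖S.Λ / (S.b S.j₀ : ℚ_[p])‖ * (p : ℝ) ^ ((S.tS Sc lev - 1) / 2) *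
            (p : ℝ) ^ condExp p (2 * S.NS Sc lev S.n + 1) (S.tS Sc lev))
        (BwC (p := p) Sc.L₀ Sc.H Sc.m / ((p : ℝ) ^ Sc.m * Real.sqrt p) ^ ((2 * S.NS Sc lev S.n + 1) * S.tS Sc lev)) <
      (S.DC (S.Lb (S.sideS Sc) lev) Sc.H s₁ τ : ℝ) /
        (4 * (S.DC (S.Lb (S.sideS Sc) lev) Sc.H s₁ τ : ℝ) ^ 2 * (1 + (S.UcardS Sc : ℝ) * (S.PmaxS Sc) * S.MhC (S.Lb (S.sideS Sc) lev) Sc.L₀ Sc.H Sc.Sd lev s₁ τ) *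
          CW77.heightProd S.α ^ 3) ^ (2 ^ (S.n + 1))) ∧
  (∀ lev < Sc.Sd, ∀ x₁ : ℤ, |x₁| ≤ (S.NS Sc (lev + 1) 1 : ℤ) → ∀ τ : Tau S.n, tauNorm τ + S.tS Sc (lev + 1) ≤ S.TordS Sc (lev + 1) 0 →
      max (BwC (p := p) Sc.L₀ Sc.H Sc.m * ‖S.Λ / (S.b S.j₀ : ℚ_[p])‖ * (p : ℝ) ^ ((S.tS Sc (lev + 1) - 1) / 2) *
            (p : ℝ) ^ condExp p (2 * S.NhS Sc (lev + 1)) (S.tS Sc (lev + 1)))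
        (BwC (p := p) Sc.L₀ Sc.H Sc.m / ((p : ℝ) ^ Sc.m * Real.sqrt p) ^ ((2 * S.NhS Sc (lev + 1)) * S.tS Sc (lev + 1))) <
      1 / S.KC (S.UcardS Sc) (S.PmaxS Sc) Sc.L₀ Sc.H Sc.Sd (lev + 1) (S.Lb (S.sideS Sc) (lev + 1)) x₁ τ) ∧
  (∀ lev < Sc.Sd, ∀ ν, 1 ≤ ν → ν < S.n → ∀ x₁ : ℤ, |x₁| ≤ (S.NS Sc (lev + 1) (ν + 1) : ℤ) →
      ∀ τ : Tau S.n, tauNorm τ + S.tS Sc (lev + 1) ≤ S.TordS Sc (lev + 1) ν →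
      max (BwC (p := p) Sc.L₀ Sc.H Sc.m * ‖S.Λ / (S.b S.j₀ : ℚ_[p])‖ * (p : ℝ) ^ ((S.tS Sc (lev + 1) - 1) / 2) *
            (p : ℝ) ^ condExp p (2 * S.NS Sc (lev + 1) ν + 1) (S.tS Sc (lev + 1)))
        (BwC (p := p) Sc.L₀ Sc.H Sc.m / ((p : ℝ) ^ Sc.m * Real.sqrt p) ^ ((2 * S.NS Sc (lev + 1) ν + 1) * S.tS Sc (lev + 1))) <
      1 / S.KC (S.UcardS Sc) (S.PmaxS Sc) Sc.L₀ Sc.H Sc.Sd (lev + 1) (S.Lb (S.sideS Sc) (lev + 1)) x₁ τ)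

/-- **The supply from the pack** + the `Λ`-order line + END sizing + the record obligations. [cite: Nesterenko2003, Prop 4.1, §5; shape only] -/
theorem recordSupplyAt'_of_pack (hn : 1 ≤ S.n) (C : ℕ → ℝ) (V : Fin S.n → ℝ) (Vmax W : ℝ) (X' S₀ D₀ : ℕ) (D : Fin S.n → ℕ)
    (hne : ∏ j, S.α j ^ S.b j ≠ 1)
    (hord : ((Sc.m + 1 : ℕ) : ℤ) + padicValInt p (S.b S.j₀) ≤ padicValRat p (∏ j, S.α j ^ S.b j - 1))
    (hpack : S.IneqPack Sc)
    (hXfin : 2 * ((S.n + 1) * X') ≤ S.NS Sc Sc.Sd S.n) (hSfin : (S.n + 1) * S₀ < S.TordS Sc Sc.Sd S.n) (hD₀ : Sc.L₀ ≤ D₀)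
    (hD : ∀ j, 2 * S.Lb (S.sideS Sc) Sc.Sd j ≤ D j) (hrec : RecordOdd C p S.n V Vmax W D₀ S₀ X' D) :
    S.RecordSupplyAt' C V Vmax W := by
  obtain ⟨hB1, hK0, hH, hO, hK⟩ := hpack
  exact S.recordSupplyAt'_of_ineqS Sc hn C V Vmax W X' S₀ D₀ D hne hord hB1 hK0 hH hO hK hXfin hSfin hD₀ hD hrec

end G3Setup

end Summit.ABC.StewartYu

end
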